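import Literature.AlgebraicGeometry.ShimuraVarieties.UnitaryAuxiliaryComplexStructureEquivariance
import Literature.AlgebraicGeometry.ShimuraVarieties.UnitaryAuxiliaryTorusDatum
import Literature.NumberTheory.Automorphic.AdelicDoubleQuotientDissection
import HarnessLib

/-!
# The Siegel point `[J_{β,Φ}(x), ũ_β(a,t)·K]` is well defined on double cosets

Topic `AlgebraicGeometry/ShimuraVarieties`; namespace `Literature.AlgebraicGeometry.ShimuraVarieties.UnitaryCanonicalModel.Aux`.
Theorems only (no definition, no named fact, no instance).  The set-theoretic half of the map of Shimura SETS
`Sh_{K_V × L_V}(U(H) × T₀, X × {h_Φ})(ℂ) → Sh_K(GSp_δ, S^±)(ℂ)`, `([x, aK_V], [t]) ↦ [J_{β,Φ}(x), ũ_β(a,t)·K]`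
([Deligne 1971] Prop. 1.15, [Milne 2005] Lemma 5.13): it is well defined because `ũ_β` is a group map defined over `ℚ`
(★ `gspRationalToFinAdelic_auxToGspRat`), intertwines the actions on `X` (★ `auxComplexStructure_ratToU21_smul_torus`)
and sends the product level `K_V × L_V` into `K` (hypothesis `hle`).

* `siegelShimuraSet_mk_eq_of_rel` — equal double cosets `[x, aK_V] = [x', a'K_V]` and equal torus classes `[t] = [t']`
  give equal Siegel points;
* `exists_siegelPointMap` — hence the class map `(p, [x, aK_V]) ↦ [J_x, ũ(a, t_p)·K]` exists.

Cell `hodgecm-mathlib`, fan B (T3) receptacle `F1ExtHodgeType` v4.1, leaf α of `stub_S2pair` (statements = B-plan2's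
spec `B-plan/specs/S2pairLeaves.sketch.B-plan2g5.lean` :28–:54 verbatim).

## References
* [Deligne1971TravauxShimura] P. Deligne, *Travaux de Shimura*, Sém. Bourbaki 389 (1971), Prop. 1.15 p. 132.
* [Milne2005ShimuraVarieties] J. S. Milne, *Introduction to Shimura varieties* (2005), §5 (5.1) p. 56, Lemma 5.13 p. 57.
-/

set_option autoImplicit false

noncomputable section

open Function MulAction NumberField IsDedekindDomain Matrix
open scoped Matrix ComplexOrder
open Literature.NumberTheory.Automorphic Literature.NumberTheory.Automorphic.UnitaryGroup
open Literature.NumberTheory.Automorphic.Liu2021.AppendixC (C5.OpenCompactSubgroup)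
open Literature.Geometry.ComplexHyperbolic Literature.Geometry.ComplexHyperbolic.BallModel
open Literature.AlgebraicGeometry.ModuliOfAbelianVarieties
open Literature.AlgebraicGeometry.Motives (CMType)

namespace Literature.AlgebraicGeometry.ShimuraVarieties

namespace UnitaryCanonicalModel

namespace Aux

variable {L : Type} [Field L] [NumberField L] [IsCMField L]
variable {H : Matrix (Fin 3) (Fin 3) L}
variable (M : Type) [Field M] [NumberField M] [IsCMField M] {j : L →+* M} {ξ₀ ξ : M} {g : ℕ} {δ : Fin g → ℕ}

/-- **The Siegel point `[J_x, ũ(a,t)·K]` depends only on `([x, aK_V], [t])`** at any level `K ⊇ ũ(K_V × L_V)`: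
if `[x, aK_V] = [x', a'K_V]` in `Sh_{K_V}(U(H), X)(ℂ)` and `[t] = [t']` in `T₀(ℚ)∖T₀(𝔸_f)/L_V`, then
`[J_{β,Φ}(x), ũ_β(a,t)·K] = [J_{β,Φ}(x'), ũ_β(a',t')·K]` in `Sh_K(GSp_δ, S^±)(ℂ)` (with `γ ∈ U(H)(ℚ)`, `k ∈ K_V`
from the first relation and `t' = t·β·l`, `β ∈ T₀(ℚ)`, `l ∈ L_V` from the second, the rational element
`ũ(γ, β⁻¹) ∈ GSp_δ(ℚ)` does it: equivariance of `J_{β,Φ}` ★ `auxComplexStructure_ratToU21_smul_torus`, the square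
★ `gspRationalToFinAdelic_auxToGspRat`, and `ũ(k, l) ∈ K`).
[cite: Deligne1971TravauxShimura, Prop. 1.15 p. 132] [cite: Milne2005ShimuraVarieties, Lemma 5.13 p. 57] -/
theorem siegelShimuraSet_mk_eq_of_rel (F : SymplecticFrame M j H ξ₀ ξ g δ) (τ : L →+* ℂ) (Φ : CMType M) (T : GL (Fin 3) ℂ)
    (hT : formCongr (starRingEnd ℂ) T (H.map τ) = BallModel.J)
    (hJ : ∀ x : Ball, auxComplexStructure F τ Φ T x ∈ C0pm δ)
    (KV : Subgroup ↥(finAdelic (↥(maximalRealSubfield L)) L (IsCMField.complexConj L) 3 H))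
    (LV : C5.OpenCompactSubgroup ↥(torusFinAdelic M)) (K : Subgroup (gspFinAdelic δ))
    (hle : KV.prod LV.1 ≤ K.comap (auxToGspFin F))
    {x x' : Ball} {a a' : ↥(finAdelic (↥(maximalRealSubfield L)) L (IsCMField.complexConj L) 3 H)}
    {t t' : ↥(torusFinAdelic M)}
    (hxa : ShimuraSet.mk L H τ T hT KV x a = ShimuraSet.mk L H τ T hT KV x' a')
    (ht : classOf M LV t = classOf M LV t') :
    SiegelShimuraSet.mk δ K ⟨auxComplexStructure F τ Φ T x, hJ x⟩ (auxToGspFin F (a, t)) =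
      SiegelShimuraSet.mk δ K ⟨auxComplexStructure F τ Φ T x', hJ x'⟩ (auxToGspFin F (a', t')) := by
  -- the unitary relation: `γ • x' = x`, `k := a⁻¹ γ_𝔸 a' ∈ K_V`
  obtain ⟨γ, hx, hk⟩ := (ShimuraSet.mk_eq_mk_iff L H τ T hT KV x x' a a').1 hxa
  -- the torus relation: `t' = t · β_𝔸 · l`, `β ∈ T₀(ℚ)`, `l ∈ L_V`
  obtain ⟨z, hz, htz⟩ := (QuotientGroup.mk'_eq_mk' _).1 ht
  obtain ⟨y, hy, l, hl, hyl⟩ := Subgroup.mem_sup.1 hz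
  obtain ⟨β, rfl⟩ := hy
  have hβt : toTorusFinAdelic M β⁻¹ * t' = t * l := by
    rw [← htz, ← hyl, map_inv, mul_left_comm, inv_mul_cancel_left]
  -- the rational element `ũ(γ, β⁻¹)`
  refine (SiegelShimuraSet.mk_eq_mk_iff δ K _ _ _ _).2 ⟨auxToGspRat F (γ, β⁻¹), ?_, ?_⟩
  · -- equivariance of the complex structure
    apply Subtype.ext
    rw [coe_conjAct]
    change _ = auxComplexStructure F τ Φ T x
    rw [← hx]
    exact (auxComplexStructure_ratToU21_smul_torus F τ Φ T hT γ β⁻¹ x').symm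
  · -- the finite-adelic classes: `ũ(γ,β⁻¹)_𝔸 · ũ(a',t') = ũ(a,t) · ũ(k,l)` with `ũ(k,l) ∈ K`
    rw [gspRationalToFinAdelic_auxToGspRat]
    change ((auxToGspFin F (rationalToFinAdelic _ L _ 3 H γ, toTorusFinAdelic M β⁻¹) * auxToGspFin F (a', t') :
        gspFinAdelic δ) : gspFinAdelic δ ⧸ K) = (auxToGspFin F (a, t) : gspFinAdelic δ ⧸ K)
    have hpair : (rationalToFinAdelic _ L _ 3 H γ, toTorusFinAdelic M β⁻¹) * (a', t') =
        (a, t) * (a⁻¹ * (rationalToFinAdelic _ L _ 3 H γ * a'), l) := by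
      rw [Prod.mk_mul_mk, Prod.mk_mul_mk, mul_inv_cancel_left, hβt]
    rw [← map_mul, hpair, map_mul]
    apply QuotientGroup.eq.2
    rw [_root_.mul_inv_rev, mul_assoc, inv_mul_cancel, mul_one]
    exact K.inv_mem (hle (Subgroup.mem_prod.2 ⟨hk, hl⟩))

/-- **The class map `(p, [x, aK_V]) ↦ [J_{β,Φ}(x), ũ_β(a, t_p)·K]` exists** (descended form of
`siegelShimuraSet_mk_eq_of_rel`: choose representatives of the torus class and of the double coset).
[cite: Deligne1971TravauxShimura, Prop. 1.15 p. 132] [cite: Milne2005ShimuraVarieties, Lemma 5.13 p. 57] -/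
theorem exists_siegelPointMap (F : SymplecticFrame M j H ξ₀ ξ g δ) (τ : L →+* ℂ) (Φ : CMType M) (T : GL (Fin 3) ℂ)
    (hT : formCongr (starRingEnd ℂ) T (H.map τ) = BallModel.J)
    (hJ : ∀ x : Ball, auxComplexStructure F τ Φ T x ∈ C0pm δ)
    (KV : Subgroup ↥(finAdelic (↥(maximalRealSubfield L)) L (IsCMField.complexConj L) 3 H))
    (LV : C5.OpenCompactSubgroup ↥(torusFinAdelic M)) (K : Subgroup (gspFinAdelic δ))
    (hle : KV.prod LV.1 ≤ K.comap (auxToGspFin F)) :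
    ∃ φ : classGroup M LV → ShimuraSet L H τ T hT KV → SiegelShimuraSet δ K,
      ∀ (t : ↥(torusFinAdelic M)) (x : Ball) (a : ↥(finAdelic (↥(maximalRealSubfield L)) L (IsCMField.complexConj L) 3 H)),
        φ (classOf M LV t) (ShimuraSet.mk L H τ T hT KV x a) =
          SiegelShimuraSet.mk δ K ⟨auxComplexStructure F τ Φ T x, hJ x⟩ (auxToGspFin F (a, t)) := by
  classical
  -- sections of the two quotient maps
  have h₁ : Function.Surjective (classOf M LV) := QuotientGroup.mk'_surjective _
  have h₂ := ShimuraSet.mk_surjective L H τ T hT KV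
  refine ⟨fun p s => SiegelShimuraSet.mk δ K
      ⟨auxComplexStructure F τ Φ T (Function.surjInv h₂ s).1, hJ _⟩
      (auxToGspFin F ((Function.surjInv h₂ s).2, Function.surjInv h₁ p)), fun t x a => ?_⟩
  have hs : ShimuraSet.mk L H τ T hT KV (Function.surjInv h₂ (ShimuraSet.mk L H τ T hT KV x a)).1
      (Function.surjInv h₂ (ShimuraSet.mk L H τ T hT KV x a)).2 = ShimuraSet.mk L H τ T hT KV x a :=
    Function.surjInv_eq h₂ (ShimuraSet.mk L H τ T hT KV x a)
  have hp : classOf M LV (Function.surjInv h₁ (classOf M LV t)) = classOf M LV t :=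
    Function.surjInv_eq h₁ (classOf M LV t)
  exact siegelShimuraSet_mk_eq_of_rel M F τ Φ T hT hJ KV LV K hle hs hp

end Aux

end UnitaryCanonicalModel

end Literature.AlgebraicGeometry.ShimuraVarieties

end
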